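import Summits.KontsevichZagierPeriods.Zeta5Search.Barrier.ConeGammaCuspSymmetricIntComb

/-!
# ζ(5) search — BARRIER: THE ONE-SIDED GERM IN EXACT FORM — oriented jumps at the member flip points

HONEST FRAMING (cell `pub-zeta5`): systematic search; no irrationality claim unless kernel-certified. MODEL objects
under Brown–Zudilin's (28)+(30) accounting ([BZ22] = arXiv:2210.03391; (28) observed, not proved); nothing here is a
statement about `ζ(5)`, any `γ` of record, the cone's supremum (C2 OPEN) or the VALUE / SIGN of any germ or jump at a
named direction (DATA of the cell); S-E stays CONJECTURED; records in print UNMOVED. Prover P2 g27, plan (T) «the cusp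
slope itself in exact form» (INBOX 2026-08-27 l.9287), sequel of `ConeGammaCuspSymmetricDForm` / `…Jumps` / `…IntComb`.

The cusp slope `σ(δ) = cuspSlope a T δ` is a sum of ONE-SIDED germs `K_b(δ) = germR(δ)(b) + germL(δ)(b)` over the
breakpoints of one period (`cuspSlope_eq_sum_germs`). Along the local line `x ↦ Δ_x = η(x·s(a) + δ)` the germ reads
`K_b(δ) = ∫_{−W}^{W} [𝒩(θ_b + Δ_w) − 𝒩(θ_b + ηw·s)] dw` (`germ_pair_eq_integral`, `shiftDiff_line`); the first term is a
step function on the cells of the member flip set (`torusN_line_eq_of_same_signs`), the second is the right / left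
orbit value `𝒩(θ_b ± t·s)` according to the sign of `w` (`torusN_lineStep_eq_of_pos` / `_of_neg`). Hence:
* **`germ_pair_eq_sum_cells`** — the D′-FORM: over ANY partition `−W = c_0 < ⋯ < c_n = W` through the member flip
  points AND the point `0`, `K_b(δ) = Σ_{j<n} (c_{j+1} − c_j)·(g_j − base_j)`, `g_j = 𝒩(θ_b + Δ_{mid_j})`,
  `base_j = 𝒩(θ_b + t·s)` on the right of `0`, `𝒩(θ_b − t·s)` on the left; `torusN_line_cell_first` / `_last`: the
  outer cells carry `g = base`;
* **`germ_pair_eq_sum_jumps`** — Abel summation; the baseline's own jump sits at the partition point `0` and is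
  multiplied by `0`: `K_b(δ) = Σ_{0<i<n} c_i·(g_{i−1} − g_i)`;
* **`germ_jumps_sum`** — `Σ_{0<i<n} (g_i − g_{i−1}) = 𝒩(θ_b + t·s) − 𝒩(θ_b − t·s)`, the ORBIT JUMP at `b`.
So every one-sided germ is `K_b(δ) = Σ_k (φ_k(δ)/h_k(a))·j_{b,k}` with integer jumps adding up to the orbit jump — the
companion `ConeGammaCuspSlopeIntComb` proves their WALL ORIENTATION (`−#(S ∩ F^c) ≤ j ≤ #(S ∩ F)`), constructs the
partition and sums over the period. DESK (DATA,
`HOME/pub-zeta5-p2/g27/alg/germform.py`, exact): 0 failures / 0 orientation violations at every junction × displacement of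
record/41, flag/60, argmax-120, t*/480 (22,044 pairs); the re-summed `S(v)` equals P2 g11's sealed values digit for
digit. NOT here (honest): any value at a named direction; anything about `γ`, C2, S-E, `ζ(5)`.
-/

noncomputable section

open Set MeasureTheory
open scoped Topology

namespace Summit.KontsevichZagierPeriods.Zeta5Search.Barrier.ConeGamma

/-! ### The one-sided germ as an integral over `[−W, W]` -/

/-- **`K_b(δ) = ∫_{−W}^{W} D_η(b + ηw) dw`**: the right and left germ integrals are the two halves of one integral. -/
theorem germ_pair_eq_integral (a : Dir) (δ : Fin 8 → ℝ) (η b : ℝ) :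
    germR a δ η b + germL a δ η b =
      ∫ w in (-clusterWidth a δ)..clusterWidth a δ, shiftDiff a δ η (b + η * w) := by
  unfold germR germL
  rw [add_comm]
  exact intervalIntegral.integral_add_adjacent_intervals
    (intervalIntegrable_shiftDiff_affine a δ η b η _ _) (intervalIntegrable_shiftDiff_affine a δ η b η _ _)

/-- The germ integrand in local-line form: `D_η(b + ηw) = 𝒩(θ_b + η(w·s + δ)) − 𝒩(θ_b + (ηw)·s)`. -/
theorem shiftDiff_line (a : Dir) (δ : Fin 8 → ℝ) (η b w : ℝ) :
    shiftDiff a δ η (b + η * w) =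
      (torusN (b • sParam a + η • (w • sParam a + δ)) : ℝ) - torusN (b • sParam a + (η * w) • sParam a) := by
  unfold shiftDiff
  rw [(bkpt_disp_affine a b η w δ).1, add_smul]

/-! ### One-sided cell constancy and the baseline -/

/-- **ONE-SIDED CELL CONSTANCY.** For `x, y ∈ [−W, W]` at which every member form has the same strict sign:
`𝒩(θ_b + η(x·s+δ)) = 𝒩(θ_b + η(y·s+δ))` (`torusN_eq_of_member_signs`). -/
theorem torusN_line_eq_of_same_signs {a : Dir} (hpos : ∀ k, 0 < h28 a k) {T b : ℝ} (hb : b ∈ bkpts a T)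
    (δ : Fin 8 → ℝ) {η : ℝ} (hη : 0 < η) (h1 : η * clusterBound a δ < 1) (h2 : η * clusterBound a δ < wallDist a T)
    {x y : ℝ} (hx : |x| ≤ clusterWidth a δ) (hy : |y| ≤ clusterWidth a δ)
    (hsame : ∀ k, (∃ z : ℤ, b * h28 a k = z) →
      (0 < x * h28 a k + phiForm δ k ∧ 0 < y * h28 a k + phiForm δ k) ∨
        (x * h28 a k + phiForm δ k < 0 ∧ y * h28 a k + phiForm δ k < 0)) :
    torusN (b • sParam a + η • (x • sParam a + δ)) = torusN (b • sParam a + η • (y • sParam a + δ)) := by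
  obtain ⟨hx1, hx2⟩ := disp_small hpos δ hη h1 h2 hx (T := T)
  obtain ⟨hy1, hy2⟩ := disp_small hpos δ hη h1 h2 hy (T := T)
  exact torusN_eq_of_member_signs hb hx1 hx2 hy1 hy2 fun k hk => by
    rw [phiForm_disp, phiForm_disp]
    rcases hsame k hk with ⟨hp, hp'⟩ | ⟨hn, hn'⟩
    · exact Or.inl ⟨mul_pos hη hp, mul_pos hη hp'⟩
    · exact Or.inr ⟨mul_neg_of_pos_of_neg hη hn, mul_neg_of_pos_of_neg hη hn'⟩

/-- A line step `c = ηw` with `0 < w ≤ W` is below the walls: `c·x_max < 1` and `c·x_max < wallDist a T`. -/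
theorem lineStep_small {a : Dir} (hpos : ∀ k, 0 < h28 a k) {T : ℝ} (δ : Fin 8 → ℝ) {η : ℝ} (hη : 0 < η)
    (h1 : η * clusterBound a δ < 1) (h2 : η * clusterBound a δ < wallDist a T) {w : ℝ} (hw0 : 0 < w)
    (hwW : w ≤ clusterWidth a δ) :
    0 < η * w ∧ η * w * xMax a < 1 ∧ η * w * xMax a < wallDist a T := by
  have hsx : η * w * xMax a ≤ η * clusterBound a δ := by
    calc η * w * xMax a ≤ η * clusterWidth a δ * xMax a :=
          mul_le_mul_of_nonneg_right (mul_le_mul_of_nonneg_left hwW hη.le) (xMax_pos hpos).le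
      _ ≤ η * clusterBound a δ := by
          rw [mul_assoc]; exact mul_le_mul_of_nonneg_left (clusterWidth_mul_xMax_le_clusterBound a δ) hη.le
  exact ⟨mul_pos hη hw0, hsx.trans_lt h1, hsx.trans_lt h2⟩

/-- **The baseline right of `b`**: for `0 < w ≤ W` and a line step `t` below the walls,
`𝒩(θ_b + (ηw)·s) = 𝒩(θ_b + t·s)` (all members positive at both). -/
theorem torusN_lineStep_eq_of_pos {a : Dir} (hpos : ∀ k, 0 < h28 a k) {T b : ℝ} (hb : b ∈ bkpts a T)
    (δ : Fin 8 → ℝ) {η : ℝ} (hη : 0 < η) (h1 : η * clusterBound a δ < 1) (h2 : η * clusterBound a δ < wallDist a T)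
    {t : ℝ} (ht : 0 < t) (ht1 : t * xMax a < 1) (ht2 : t * xMax a < wallDist a T) {w : ℝ} (hw0 : 0 < w)
    (hwW : w ≤ clusterWidth a δ) :
    torusN (b • sParam a + (η * w) • sParam a) = torusN (b • sParam a + t • sParam a) := by
  obtain ⟨hs, hs1, hs2⟩ := lineStep_small hpos δ hη h1 h2 hw0 hwW (T := T)
  have hA1 := fun k => phiForm_line_step_small hpos hs hs1 k
  have hA2 := fun k => phiForm_line_step_small hpos hs hs2 k
  have hB1 := fun k => phiForm_line_step_small hpos ht ht1 k
  have hB2 := fun k => phiForm_line_step_small hpos ht ht2 k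
  exact torusN_eq_of_member_signs hb (fun k => (hA1 k).2.2.2.1) (fun k => (hA2 k).2.2.2.1)
    (fun k => (hB1 k).2.2.2.1) (fun k => (hB2 k).2.2.2.1) fun k _ =>
      Or.inl ⟨by rw [(hA1 k).1]; exact (hA1 k).2.2.1, by rw [(hB1 k).1]; exact (hB1 k).2.2.1⟩

/-- **The baseline left of `b`**: for `−W ≤ w < 0` and a line step `t` below the walls,
`𝒩(θ_b + (ηw)·s) = 𝒩(θ_b − t·s)` (all members negative at both). -/
theorem torusN_lineStep_eq_of_neg {a : Dir} (hpos : ∀ k, 0 < h28 a k) {T b : ℝ} (hb : b ∈ bkpts a T)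
    (δ : Fin 8 → ℝ) {η : ℝ} (hη : 0 < η) (h1 : η * clusterBound a δ < 1) (h2 : η * clusterBound a δ < wallDist a T)
    {t : ℝ} (ht : 0 < t) (ht1 : t * xMax a < 1) (ht2 : t * xMax a < wallDist a T) {w : ℝ} (hw0 : w < 0)
    (hwW : -clusterWidth a δ ≤ w) :
    torusN (b • sParam a + (η * w) • sParam a) = torusN (b • sParam a - t • sParam a) := by
  obtain ⟨hs, hs1, hs2⟩ := lineStep_small hpos δ hη h1 h2 (neg_pos.mpr hw0) (by linarith : -w ≤ clusterWidth a δ)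
    (T := T)
  have hA1 := fun k => phiForm_line_step_small hpos hs hs1 k
  have hA2 := fun k => phiForm_line_step_small hpos hs hs2 k
  have hB1 := fun k => phiForm_line_step_small hpos ht ht1 k
  have hB2 := fun k => phiForm_line_step_small hpos ht ht2 k
  rw [show (η * w) • sParam a = (-(η * -w)) • sParam a by rw [mul_neg, neg_neg], sub_eq_add_neg, ← neg_smul]
  exact torusN_eq_of_member_signs hb (fun k => (hA1 k).2.2.2.2) (fun k => (hA2 k).2.2.2.2)
    (fun k => (hB1 k).2.2.2.2) (fun k => (hB2 k).2.2.2.2) fun k _ =>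
      Or.inr ⟨by rw [(hA1 k).2.1]; linarith [(hA1 k).2.2.1], by rw [(hB1 k).2.1]; linarith [(hB1 k).2.2.1]⟩

/-! ### The D′-form of the one-sided germ over a partition through the flip points and `0` -/

/-- **THE ONE-SIDED GERM IN EXACT FORM (D′-form).** Let all 28 forms of `a` be positive, `b ∈ bkpts a T`, `δ` a
displacement, `0 < η` with `ηK < 1`, `ηK < wallDist a T`, `t > 0` a line step below the walls, and
`−W = c_0 < ⋯ < c_n = W` a partition passing through every member flip point AND through `0`. Then
`germR(δ)(b) + germL(δ)(b) = Σ_{j<n} (c_{j+1} − c_j)·(𝒩(θ_b + η(m_j·s+δ)) − base_j)`, `m_j` the midpoint of cell `j`,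
`base_j = 𝒩(θ_b + t·s)` if `m_j > 0` and `𝒩(θ_b − t·s)` if not. -/
theorem germ_pair_eq_sum_cells {a : Dir} (hpos : ∀ k, 0 < h28 a k) {T b : ℝ} (hb : b ∈ bkpts a T)
    (δ : Fin 8 → ℝ) {η : ℝ} (hη : 0 < η) (h1 : η * clusterBound a δ < 1) (h2 : η * clusterBound a δ < wallDist a T)
    {t : ℝ} (ht : 0 < t) (ht1 : t * xMax a < 1) (ht2 : t * xMax a < wallDist a T)
    {n : ℕ} {c : ℕ → ℝ} (hc0 : c 0 = -clusterWidth a δ) (hcn : c n = clusterWidth a δ)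
    (hmono : ∀ j < n, c j < c (j + 1))
    (hflip : ∀ k, (∃ z : ℤ, b * h28 a k = z) → ∃ i ≤ n, c i = -(phiForm δ k / h28 a k))
    (hzero : ∃ i ≤ n, c i = 0) :
    germR a δ η b + germL a δ η b =
      ∑ j ∈ Finset.range n, (c (j + 1) - c j) *
        ((torusN (b • sParam a + η • (((c j + c (j + 1)) / 2) • sParam a + δ)) : ℝ) -
          if 0 < (c j + c (j + 1)) / 2 then (torusN (b • sParam a + t • sParam a) : ℝ)
          else (torusN (b • sParam a - t • sParam a) : ℝ)) := by
  rw [germ_pair_eq_integral, ← hc0, ← hcn]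
  have hIi := fun α β => intervalIntegrable_shiftDiff_affine a δ η b η α β
  rw [← intervalIntegral.sum_integral_adjacent_intervals fun k _ => hIi (c k) (c (k + 1))]
  obtain ⟨i₀, hi₀n, hci₀⟩ := hzero
  refine Finset.sum_congr rfl fun j hj => ?_
  have hj' : j < n := Finset.mem_range.mp hj
  have hlt : c j < c (j + 1) := hmono j hj'
  have hlo : -clusterWidth a δ ≤ c j := by rw [← hc0]; exact chain_mono hmono (Nat.zero_le j) hj'.le
  have hhi : c (j + 1) ≤ clusterWidth a δ := by rw [← hcn]; exact chain_mono hmono (Nat.succ_le_of_lt hj') le_rfl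
  have hmid : c j < (c j + c (j + 1)) / 2 ∧ (c j + c (j + 1)) / 2 < c (j + 1) := ⟨by linarith, by linarith⟩
  have hmidW : |(c j + c (j + 1)) / 2| ≤ clusterWidth a δ := abs_le.mpr ⟨by linarith, by linarith⟩
  -- the cell lies on one side of `0 = c_{i₀}`
  have hside : 0 ≤ c j ∨ c (j + 1) ≤ 0 := by
    rcases le_or_gt i₀ j with h | h
    · exact Or.inl (hci₀ ▸ chain_mono hmono h hj'.le)
    · exact Or.inr (hci₀ ▸ chain_mono hmono (Nat.succ_le_of_lt h) hi₀n)
  have hcongr : ∫ x in (c j)..(c (j + 1)), shiftDiff a δ η (b + η * x) =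
      ∫ x in (c j)..(c (j + 1)),
        ((torusN (b • sParam a + η • (((c j + c (j + 1)) / 2) • sParam a + δ)) : ℝ) -
          if 0 < (c j + c (j + 1)) / 2 then (torusN (b • sParam a + t • sParam a) : ℝ)
          else (torusN (b • sParam a - t • sParam a) : ℝ)) := by
    refine intervalIntegral.integral_congr_ae ?_
    have hae : ∀ᵐ x ∂volume, x ∉ ({c (j + 1)} : Set ℝ) :=
      (measure_eq_zero_iff_ae_notMem).mp (measure_singleton _)
    filter_upwards [hae] with x hxB hxI
    rw [uIoc_of_le hlt.le] at hxI
    have hxlt : x < c (j + 1) := lt_of_le_of_ne hxI.2 fun h => hxB (Set.mem_singleton_iff.mpr h)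
    have hxW : |x| ≤ clusterWidth a δ := abs_le.mpr ⟨by linarith [hxI.1], by linarith⟩
    rw [shiftDiff_line, torusN_line_eq_of_same_signs hpos hb δ hη h1 h2 hxW hmidW
      (member_signs_on_cell hpos δ hmono hflip hj' ⟨hxI.1, hxlt⟩ hmid)]
    rcases hside with h0 | h0
    · have hx0 : 0 < x := by linarith [hxI.1]
      rw [if_pos (by linarith : 0 < (c j + c (j + 1)) / 2),
        torusN_lineStep_eq_of_pos hpos hb δ hη h1 h2 ht ht1 ht2 hx0 (by linarith)]
    · have hx0 : x < 0 := by linarith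
      rw [if_neg (by linarith : ¬ 0 < (c j + c (j + 1)) / 2),
        torusN_lineStep_eq_of_neg hpos hb δ hη h1 h2 ht ht1 ht2 hx0 (by linarith [hxI.1])]
  rw [hcongr, intervalIntegral.integral_const, smul_eq_mul]

/-- **On the FIRST cell every member is negative**: `𝒩(θ_b + η(m_0·s + δ)) = 𝒩(θ_b − t·s)` (`0 < n`; the flip points
`c_i` have `i ≠ 0` since they lie inside `(−W, W)`). -/
theorem torusN_line_cell_first {a : Dir} (hpos : ∀ k, 0 < h28 a k) {T b : ℝ} (hb : b ∈ bkpts a T)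
    (δ : Fin 8 → ℝ) {η : ℝ} (hη : 0 < η) (h1 : η * clusterBound a δ < 1) (h2 : η * clusterBound a δ < wallDist a T)
    {t : ℝ} (ht : 0 < t) (ht1 : t * xMax a < 1) (ht2 : t * xMax a < wallDist a T)
    {n : ℕ} {c : ℕ → ℝ} (hn : 0 < n) (hc0 : c 0 = -clusterWidth a δ) (hcn : c n = clusterWidth a δ)
    (hmono : ∀ j < n, c j < c (j + 1))
    (hflip : ∀ k, (∃ z : ℤ, b * h28 a k = z) → ∃ i ≤ n, c i = -(phiForm δ k / h28 a k)) :
    torusN (b • sParam a + η • (((c 0 + c 1) / 2) • sParam a + δ)) = torusN (b • sParam a - t • sParam a) := by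
  have hlt : c 0 < c 1 := hmono 0 hn
  have hhi : c 1 ≤ clusterWidth a δ := by rw [← hcn]; exact chain_mono hmono (Nat.succ_le_of_lt hn) le_rfl
  have hmidW : |(c 0 + c 1) / 2| ≤ clusterWidth a δ := abs_le.mpr ⟨by linarith, by linarith⟩
  obtain ⟨hx1, hx2⟩ := disp_small hpos δ hη h1 h2 hmidW (T := T)
  have hB1 := fun k => phiForm_line_step_small hpos ht ht1 k
  have hB2 := fun k => phiForm_line_step_small hpos ht ht2 k
  rw [sub_eq_add_neg, ← neg_smul]
  refine torusN_eq_of_member_signs hb hx1 hx2 (fun k => (hB1 k).2.2.2.2) (fun k => (hB2 k).2.2.2.2) fun k hk => ?_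
  have hk0 := hpos k
  obtain ⟨i, hin, hci⟩ := hflip k hk
  have hi0 : i ≠ 0 := by
    rintro rfl
    have hW := abs_flip_lt_clusterWidth hpos δ k
    rw [← neg_neg (phiForm δ k / h28 a k), ← hci, abs_neg, hc0, abs_neg,
      abs_of_pos (clusterWidth_pos hpos δ)] at hW
    exact lt_irrefl _ hW
  have hle : c 1 ≤ c i := chain_mono hmono (Nat.one_le_iff_ne_zero.mpr hi0) hin
  refine Or.inr ⟨?_, by rw [(hB1 k).2.1]; linarith [(hB1 k).2.2.1]⟩
  rw [phiForm_disp, line_form_eq_mul_sub hk0 hci]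
  exact mul_neg_of_pos_of_neg hη (mul_neg_of_pos_of_neg hk0 (by linarith))

/-- **On the LAST cell every member is positive**: `𝒩(θ_b + η(m_{n−1}·s + δ)) = 𝒩(θ_b + t·s)` (`0 < n`). -/
theorem torusN_line_cell_last {a : Dir} (hpos : ∀ k, 0 < h28 a k) {T b : ℝ} (hb : b ∈ bkpts a T)
    (δ : Fin 8 → ℝ) {η : ℝ} (hη : 0 < η) (h1 : η * clusterBound a δ < 1) (h2 : η * clusterBound a δ < wallDist a T)
    {t : ℝ} (ht : 0 < t) (ht1 : t * xMax a < 1) (ht2 : t * xMax a < wallDist a T)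
    {n : ℕ} {c : ℕ → ℝ} (hn : 0 < n) (hc0 : c 0 = -clusterWidth a δ) (hcn : c n = clusterWidth a δ)
    (hmono : ∀ j < n, c j < c (j + 1))
    (hflip : ∀ k, (∃ z : ℤ, b * h28 a k = z) → ∃ i ≤ n, c i = -(phiForm δ k / h28 a k)) :
    torusN (b • sParam a + η • (((c (n - 1) + c n) / 2) • sParam a + δ)) = torusN (b • sParam a + t • sParam a) := by
  have hn1 : n - 1 < n := Nat.sub_lt hn Nat.one_pos
  have hlt : c (n - 1) < c n := by
    have := hmono (n - 1) hn1
    rwa [Nat.sub_add_cancel hn] at this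
  have hlo : -clusterWidth a δ ≤ c (n - 1) := by rw [← hc0]; exact chain_mono hmono (Nat.zero_le _) hn1.le
  have hmidW : |(c (n - 1) + c n) / 2| ≤ clusterWidth a δ := abs_le.mpr ⟨by linarith, by linarith⟩
  obtain ⟨hx1, hx2⟩ := disp_small hpos δ hη h1 h2 hmidW (T := T)
  have hB1 := fun k => phiForm_line_step_small hpos ht ht1 k
  have hB2 := fun k => phiForm_line_step_small hpos ht ht2 k
  refine torusN_eq_of_member_signs hb hx1 hx2 (fun k => (hB1 k).2.2.2.1) (fun k => (hB2 k).2.2.2.1) fun k hk => ?_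
  have hk0 := hpos k
  obtain ⟨i, hin, hci⟩ := hflip k hk
  have hin' : i ≠ n := by
    rintro rfl
    have hW := abs_flip_lt_clusterWidth hpos δ k
    rw [← neg_neg (phiForm δ k / h28 a k), ← hci, abs_neg, hcn, abs_of_pos (clusterWidth_pos hpos δ)] at hW
    exact lt_irrefl _ hW
  have hle : c i ≤ c (n - 1) := chain_mono hmono (Nat.le_sub_one_of_lt (lt_of_le_of_ne hin hin')) hn1.le
  refine Or.inl ⟨?_, by rw [(hB1 k).1]; exact (hB1 k).2.2.1⟩
  rw [phiForm_disp, line_form_eq_mul_sub hk0 hci]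
  exact mul_pos hη (mul_pos hk0 (by linarith))

/-! ### Abel summation: the JUMP FORM of the one-sided germ -/

/-- **THE ONE-SIDED GERM AS A SUM OF JUMPS.** Under the hypotheses of `germ_pair_eq_sum_cells` with `0 < n`:
`germR(δ)(b) + germL(δ)(b) = Σ_{0<i<n} c_i · (g_{i−1} − g_i)`, `g_j = 𝒩(θ_b + η(m_j·s + δ))` — the baseline disappears:
it is constant on either side of `0`, and its jump sits at the partition point `c_i = 0`, multiplied by `0`. -/
theorem germ_pair_eq_sum_jumps {a : Dir} (hpos : ∀ k, 0 < h28 a k) {T b : ℝ} (hb : b ∈ bkpts a T)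
    (δ : Fin 8 → ℝ) {η : ℝ} (hη : 0 < η) (h1 : η * clusterBound a δ < 1) (h2 : η * clusterBound a δ < wallDist a T)
    {t : ℝ} (ht : 0 < t) (ht1 : t * xMax a < 1) (ht2 : t * xMax a < wallDist a T)
    {n : ℕ} {c : ℕ → ℝ} (hn : 0 < n) (hc0 : c 0 = -clusterWidth a δ) (hcn : c n = clusterWidth a δ)
    (hmono : ∀ j < n, c j < c (j + 1))
    (hflip : ∀ k, (∃ z : ℤ, b * h28 a k = z) → ∃ i ≤ n, c i = -(phiForm δ k / h28 a k))
    (hzero : ∃ i ≤ n, c i = 0) :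
    germR a δ η b + germL a δ η b =
      ∑ i ∈ Finset.Ico 1 n, c i *
        ((torusN (b • sParam a + η • (((c (i - 1) + c i) / 2) • sParam a + δ)) : ℝ) -
          torusN (b • sParam a + η • (((c i + c (i + 1)) / 2) • sParam a + δ))) := by
  obtain ⟨i₀, hi₀n, hci₀⟩ := hzero
  rw [germ_pair_eq_sum_cells hpos hb δ hη h1 h2 ht ht1 ht2 hc0 hcn hmono hflip ⟨i₀, hi₀n, hci₀⟩,
    sum_cells_abel c (fun j => (torusN (b • sParam a + η • (((c j + c (j + 1)) / 2) • sParam a + δ)) : ℝ) -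
      if 0 < (c j + c (j + 1)) / 2 then (torusN (b • sParam a + t • sParam a) : ℝ)
      else (torusN (b • sParam a - t • sParam a) : ℝ)) hn]
  have hF := torusN_line_cell_first hpos hb δ hη h1 h2 ht ht1 ht2 hn hc0 hcn hmono hflip
  have hL := torusN_line_cell_last hpos hb δ hη h1 h2 ht ht1 ht2 hn hc0 hcn hmono hflip
  have hW := clusterWidth_pos hpos δ
  have hn1 : n - 1 < n := Nat.sub_lt hn Nat.one_pos
  -- the two boundary terms vanish
  have hlast : 0 < (c (n - 1) + c n) / 2 := by
    have hi : i₀ ≠ n := by rintro rfl; rw [hcn] at hci₀; linarith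
    have : c i₀ ≤ c (n - 1) := chain_mono hmono (Nat.le_sub_one_of_lt (lt_of_le_of_ne hi₀n hi)) hn1.le
    have : c (n - 1) < c n := by have := hmono (n - 1) hn1; rwa [Nat.sub_add_cancel hn] at this
    linarith
  have hfirst : ¬ 0 < (c 0 + c 1) / 2 := by
    have hi : i₀ ≠ 0 := by rintro rfl; rw [hc0] at hci₀; linarith
    have : c 1 ≤ c i₀ := chain_mono hmono (Nat.one_le_iff_ne_zero.mpr hi) hi₀n
    have : c 0 < c 1 := hmono 0 hn
    linarith
  simp only [Nat.sub_add_cancel hn, zero_add] at hL ⊢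
  rw [if_pos hlast, if_neg hfirst, hF, hL, sub_self, sub_self, mul_zero, mul_zero, add_zero, sub_zero]
  refine Finset.sum_congr rfl fun i hi => ?_
  obtain ⟨hi1, hin⟩ := Finset.mem_Ico.mp hi
  rw [Nat.sub_add_cancel hi1]
  -- either `c_i = 0`, or both midpoints lie on the same side of `0`
  by_cases hci : c i = 0
  · rw [hci, zero_mul, zero_mul]
  have hlt0 : c (i - 1) < c i := by
    have := hmono (i - 1) (by omega); rwa [Nat.sub_add_cancel hi1] at this
  have hlt1 : c i < c (i + 1) := hmono i hin
  rcases lt_or_gt_of_ne hci with hneg | hposc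
  · -- `c_i < 0 = c_{i₀}`: `i + 1 ≤ i₀`, both midpoints negative
    have hii : i + 1 ≤ i₀ := by
      by_contra h
      have := chain_mono hmono (show i₀ ≤ i by omega) hin.le
      linarith
    have : c (i + 1) ≤ c i₀ := chain_mono hmono hii hi₀n
    rw [if_neg (by linarith : ¬ 0 < (c (i - 1) + c i) / 2), if_neg (by linarith : ¬ 0 < (c i + c (i + 1)) / 2)]
    ring
  · -- `0 = c_{i₀} < c_i`: `i₀ ≤ i − 1`, both midpoints positive
    have hii : i₀ ≤ i - 1 := by
      by_contra h
      have := chain_mono hmono (show i ≤ i₀ by omega) hi₀n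
      linarith
    have : c i₀ ≤ c (i - 1) := chain_mono hmono hii (by omega)
    rw [if_pos (by linarith : 0 < (c (i - 1) + c i) / 2), if_pos (by linarith : 0 < (c i + c (i + 1)) / 2)]
    ring

/-! ### The jumps telescope -/

/-- **THE JUMPS ADD UP TO THE ORBIT JUMP.** Under the partition hypotheses with `0 < n`:
`Σ_{0<i<n} (g_i − g_{i−1}) = 𝒩(θ_b + t·s) − 𝒩(θ_b − t·s)` — the jump of `N_a` across the breakpoint `b` (bounded by
`−#F^c-members` and `+#F-members`, g26's `torusN_jump_oriented`). -/
theorem germ_jumps_sum {a : Dir} (hpos : ∀ k, 0 < h28 a k) {T b : ℝ} (hb : b ∈ bkpts a T)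
    (δ : Fin 8 → ℝ) {η : ℝ} (hη : 0 < η) (h1 : η * clusterBound a δ < 1) (h2 : η * clusterBound a δ < wallDist a T)
    {t : ℝ} (ht : 0 < t) (ht1 : t * xMax a < 1) (ht2 : t * xMax a < wallDist a T)
    {n : ℕ} {c : ℕ → ℝ} (hn : 0 < n) (hc0 : c 0 = -clusterWidth a δ) (hcn : c n = clusterWidth a δ)
    (hmono : ∀ j < n, c j < c (j + 1))
    (hflip : ∀ k, (∃ z : ℤ, b * h28 a k = z) → ∃ i ≤ n, c i = -(phiForm δ k / h28 a k)) :
    ∑ i ∈ Finset.Ico 1 n,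
        (torusN (b • sParam a + η • (((c i + c (i + 1)) / 2) • sParam a + δ)) -
          torusN (b • sParam a + η • (((c (i - 1) + c i) / 2) • sParam a + δ))) =
      torusN (b • sParam a + t • sParam a) - torusN (b • sParam a - t • sParam a) := by
  rw [Finset.sum_Ico_eq_sum_range,
    Finset.sum_congr rfl fun k _ => by rw [Nat.add_sub_cancel_left, Nat.add_comm 1 k],
    Finset.sum_range_sub (fun j => torusN (b • sParam a + η • (((c j + c (j + 1)) / 2) • sParam a + δ))),
    Nat.sub_add_cancel hn, torusN_line_cell_last hpos hb δ hη h1 h2 ht ht1 ht2 hn hc0 hcn hmono hflip,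
    zero_add, torusN_line_cell_first hpos hb δ hη h1 h2 ht ht1 ht2 hn hc0 hcn hmono hflip]

end Summit.KontsevichZagierPeriods.Zeta5Search.Barrier.ConeGamma

end
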